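import Mathlib
import Summits.Ventures.PercRepro2.HCov
import Summits.Ventures.PercRepro2.A3Fibre
import Summits.Ventures.PercRepro2.A3FibreMain
import Summits.Ventures.PercRepro2.A3RootEdge
import Summits.Ventures.PercRepro2.A3RootEdgeFibre
import Summits.Ventures.PercRepro2.A3RootEdgeMeans
import Summits.Ventures.PercRepro2.A3RootEdgeClusterFns
import Summits.Ventures.PercRepro2.A3RootEdgeBetween

/-!
# The root-edge closure of (MEANS-a₃): `A3Between p[e ↦ 0] → A3Between p`
(blind cell PercRepro2, p5 g13; `proofs/P5-ROOTEDGE.md` §6, the assembly)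

For a root edge `e = {a₁, a₃}` with `D₀ = P_{p[e↦0]}(PD) > 0`, the e-split `btwg_eq_pin`
(A3RootEdgeMeans) reads `btwg p γ = t·btwg p₁ γ + (1 − t)·btwg p₀ γ + cross` at `γ = gamma p = gamma p₀`
(`gamma_eq_update_zero`), where

* `btwg p₁ γ ≥ 0` (`btwg_one_nonneg`, A3RootEdgeBetween) and `btwg p₀ γ = btw p₀ ≥ 0` (the hypothesis);
* the cross term is `t(1 − t)·(Q₀A₁ − Q₁A₀)(Q₀B₁ − Q₁B₀)/(Q·Q₀·Q₁)` (`cross_eq`) with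
  `Q₀A₁ − Q₁A₀ = df ≥ 0` (`sum_Ssig_eq_EQ`, `dfc_nonneg`) and `D₀·(Q₀B₁ − Q₁B₀) = dg ≥ 0`
  (`sum_SFg_eq`, `sum_SFg_one`, `sum_SFg_zero_mul_D`, `dgc_nonneg`) — `cross_nonneg`; the case `Q₁ = 0`
  has no cross term (`cross_eq_zero_of_Q_one`), the case `p e = 1` is `btwg_one_nonneg` itself.

Hence **`A3Between_of_update_zero`**: (MEANS-a₃) is closed under adding an edge between `a₃` and the
root `a₁`, for every instance with `D₀ > 0`.
-/

namespace Summit.Ventures.PercRepro2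

open UnionCluster

namespace CovForm

namespace RootEdge

open CCT A3Fibre

section Closure

variable {V : Type*} {E : Type*} [Fintype V] [DecidableEq V] [Fintype E] [DecidableEq E]
  {R : Type*} [Field R] [LinearOrder R] [IsStrictOrderedRing R]

variable {ends : E → Sym2 V} {e : E} {a₁ a₂ a₃ : V}

/-! ### `γ` and the sums -/

omit [Fintype V] [DecidableEq V] [LinearOrder R] [IsStrictOrderedRing R] in
/-- `D_o = (1 − p e) · D_o⁰`. -/
lemma Do_eq_pin (p : E → R) (hends : ends e = s(a₁, a₃)) (o : V) :
    Do p ends o a₁ a₂ a₃ = (1 - p e) * Do (Function.update p e 0) ends o a₁ a₂ a₃ := by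
  unfold Do
  rw [prob_eq_pin p _ e, prob_eq_pin p (PDEvent ends a₁ a₂ a₃ ∩ connEvent ends a₂ o) e,
    prob_one_PD_inter p hends a₂, prob_one_PD_inter p hends a₂]
  ring

omit [Fintype V] [DecidableEq V] [LinearOrder R] [IsStrictOrderedRing R] in
/-- `gamma p = gamma p[e ↦ 0]` when `p e ≠ 1`. -/
lemma gamma_eq_update_zero (p : E → R) (hends : ends e = s(a₁, a₃)) (o : V) (ht : p e ≠ 1) :
    gamma p ends o a₁ a₂ a₃ = gamma (Function.update p e 0) ends o a₁ a₂ a₃ := by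
  unfold gamma
  rw [Do_eq_pin p hends o, prob_PD_eq_pin p hends, mul_div_mul_left _ _ (sub_ne_zero.2 (Ne.symm ht))]

omit [Fintype V] [DecidableEq V] in
/-- `gamma ≥ 0`. -/
lemma gamma_nonneg (p : E → R) (hp : IsProbVec p) (o : V) :
    0 ≤ gamma p ends o a₁ a₂ a₃ := by
  unfold gamma Do
  exact div_nonneg (add_nonneg (prob_nonneg hp _) (prob_nonneg hp _)) (prob_nonneg hp _)

omit [LinearOrder R] [IsStrictOrderedRing R] in
/-- The `Ssig`-sum is the signed `Q`-mass of `b`. -/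
lemma sum_Ssig_eq (p : E → R) (b : V) :
    (∑ W : Finset V, Ssig p ends a₁ a₂ a₃ b W) =
      prob p (avoidAll ends a₂ {a₁} ∩ connEvent ends a₁ b) -
        prob p (avoidAll ends a₂ {a₁} ∩ connEvent ends a₂ b) := by
  have h := EQo_eq p ends b a₁ a₂ a₃
  unfold EQo at h
  exact h.symm

omit [LinearOrder R] [IsStrictOrderedRing R] in
/-- The `SFg`-sum in terms of the pattern masses. -/
lemma sum_SFg_eq (p : E → R) (o : V) (γ : R) :
    (∑ W : Finset V, SFg p ends o a₁ a₂ a₃ γ W) =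
      EQo p ends o a₁ a₂ + γ * EQ3 p ends a₁ a₂ a₃ - EQ3o p ends o a₁ a₂ a₃ := by
  rw [EQo_eq p ends o a₁ a₂ a₃, EQ3_eq, EQ3o_eq, Finset.mul_sum, ← Finset.sum_add_distrib,
    ← Finset.sum_sub_distrib]
  refine Finset.sum_congr rfl fun W _ => ?_
  unfold SFg
  ring

omit [LinearOrder R] [IsStrictOrderedRing R] in
/-- At `p[e ↦ 1]`: `∑ SFg = γ·Q₁ − 2·P₁(Q, oH)`. -/
lemma sum_SFg_one (p : E → R) (hends : ends e = s(a₁, a₃)) (o : V) (γ : R) :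
    (∑ W : Finset V, SFg (Function.update p e 1) ends o a₁ a₂ a₃ γ W) =
      γ * prob (Function.update p e 1) (avoidAll ends a₂ {a₁}) -
        2 * prob (Function.update p e 1) (avoidAll ends a₂ {a₁} ∩ connEvent ends a₂ o) := by
  rw [sum_SFg_eq]
  unfold EQo EQ3 EQ3o
  rw [prob_one_T' p hends a₂, prob_one_T p hends a₂, prob_one_T'_inter p hends a₂,
    prob_one_T'_inter p hends a₂, prob_one_T_inter p hends a₂, prob_one_T_inter p hends a₂]
  ring

omit [LinearOrder R] [IsStrictOrderedRing R] in
/-- At `γ = gamma p₀` and `D₀ ≠ 0`: `D₀ · ∑ SFg p₀ = DEF p₀`. -/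
lemma sum_SFg_zero_mul_D (p₀ : E → R) (o : V)
    (hD : prob p₀ (PDEvent ends a₁ a₂ a₃) ≠ 0) :
    prob p₀ (PDEvent ends a₁ a₂ a₃) *
        (∑ W : Finset V, SFg p₀ ends o a₁ a₂ a₃ (gamma p₀ ends o a₁ a₂ a₃) W) =
      DEF p₀ ends o a₁ a₂ a₃ := by
  rw [sum_SFg_eq]
  unfold DEF gamma
  field_simp

/-! ### The cross term -/

omit [LinearOrder R] [IsStrictOrderedRing R] in
/-- The two-point covariance identity, cleared. -/
lemma cross_identity (t A₀ A₁ B₀ B₁ Q₀ Q₁ : R) (hQ₀ : Q₀ ≠ 0) (hQ₁ : Q₁ ≠ 0)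
    (hQ : t * Q₁ + (1 - t) * Q₀ ≠ 0) :
    -((t * A₁ + (1 - t) * A₀) * (t * B₁ + (1 - t) * B₀) / (t * Q₁ + (1 - t) * Q₀)) +
        t * (A₁ * B₁ / Q₁) + (1 - t) * (A₀ * B₀ / Q₀) =
      t * (1 - t) * ((Q₀ * A₁ - Q₁ * A₀) * (Q₀ * B₁ - Q₁ * B₀)) /
        ((t * Q₁ + (1 - t) * Q₀) * Q₀ * Q₁) := by
  field_simp
  ring

/-- **(MEANS-a₃) is closed under adding an edge between `a₃` and the root `a₁`** (for `D₀ > 0`). -/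
theorem A3Between_of_update_zero (p : E → R) (hp : IsProbVec p) (o b : V)
    (hends : ends e = s(a₁, a₃))
    (hD : 0 < prob (Function.update p e 0) (PDEvent ends a₁ a₂ a₃))
    (h₀ : A3Between (Function.update p e 0) ends o a₁ a₂ a₃ b) : A3Between p ends o a₁ a₂ a₃ b := by
  have hp₀ : IsProbVec (Function.update p e 0) := hp.update e le_rfl zero_le_one
  have hp₁ : IsProbVec (Function.update p e 1) := hp.update e zero_le_one le_rfl
  unfold A3Between at h₀ ⊢
  rw [← btwg_gamma] at h₀ ⊢
  -- the case `p e = 1`: `p = p[e ↦ 1]`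
  by_cases ht : p e = 1
  · have hp1 : Function.update p e 1 = p := by
      rw [← ht]; exact Function.update_eq_self e p
    rw [← hp1]
    exact btwg_one_nonneg p hp hends o b (gamma_nonneg _ hp₁ o)
  -- `γ = gamma p = gamma p₀`
  have hγ : gamma p ends o a₁ a₂ a₃ = gamma (Function.update p e 0) ends o a₁ a₂ a₃ :=
    gamma_eq_update_zero p hends o ht
  have hγ0 : 0 ≤ gamma p ends o a₁ a₂ a₃ := gamma_nonneg p hp o
  have h1 := btwg_one_nonneg (a₂ := a₂) p hp hends o b hγ0
  rw [hγ] at h1 ⊢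
  -- the e-split
  have hsplit := btwg_eq_pin (a₂ := a₂) p hends o b (gamma (Function.update p e 0) ends o a₁ a₂ a₃)
  rw [hsplit]
  have ht0 : 0 ≤ p e := hp.nonneg e
  have ht1 : 0 ≤ 1 - p e := sub_nonneg.2 (hp.le_one e)
  have hQ0 : 0 < prob (Function.update p e 0) (avoidAll ends a₂ {a₁}) := by
    refine lt_of_lt_of_le hD (prob_mono hp₀ ?_)
    intro ω hω
    rw [avoidAll_eq_compl']
    exact hω.1
  -- the sums
  rw [sum_Ssig_eq_pin (e := e) p b, sum_SFg_eq_pin (e := e) p o, prob_eq_pin p _ e]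
  set γ := gamma (Function.update p e 0) ends o a₁ a₂ a₃ with hγdef
  set A₀ := ∑ W : Finset V, Ssig (Function.update p e 0) ends a₁ a₂ a₃ b W with hA₀
  set A₁ := ∑ W : Finset V, Ssig (Function.update p e 1) ends a₁ a₂ a₃ b W with hA₁
  set B₀ := ∑ W : Finset V, SFg (Function.update p e 0) ends o a₁ a₂ a₃ γ W with hB₀
  set B₁ := ∑ W : Finset V, SFg (Function.update p e 1) ends o a₁ a₂ a₃ γ W with hB₁
  set Q₀ := prob (Function.update p e 0) (avoidAll ends a₂ {a₁}) with hQ₀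
  set Q₁ := prob (Function.update p e 1) (avoidAll ends a₂ {a₁}) with hQ₁
  have hQ1nn : 0 ≤ Q₁ := prob_nonneg hp₁ _
  -- the two factors of the cross term
  have hdf : 0 ≤ Q₀ * A₁ - Q₁ * A₀ := by
    have := dfc_nonneg p hp ends a₁ a₂ a₃ b e hends
    rw [hA₀, hA₁, sum_Ssig_eq, sum_Ssig_eq]
    linarith
  have hdg : 0 ≤ Q₀ * B₁ - Q₁ * B₀ := by
    have hdgc := dgc_nonneg p hp ends o a₁ a₂ a₃ e hends
    have hB₁' : B₁ = γ * Q₁ - 2 * prob (Function.update p e 1) (avoidAll ends a₂ {a₁} ∩ connEvent ends a₂ o) := by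
      rw [hB₁, sum_SFg_one p hends o γ]
    have hB₀' : prob (Function.update p e 0) (PDEvent ends a₁ a₂ a₃) * B₀ =
        DEF (Function.update p e 0) ends o a₁ a₂ a₃ := by
      rw [hB₀, hγdef, sum_SFg_zero_mul_D _ o hD.ne']
    have hγD : γ * prob (Function.update p e 0) (PDEvent ends a₁ a₂ a₃) =
        Do (Function.update p e 0) ends o a₁ a₂ a₃ := by
      rw [hγdef]; unfold gamma; field_simp
    -- `D₀ · (Q₀ B₁ − Q₁ B₀) = dgc ≥ 0`
    have key : prob (Function.update p e 0) (PDEvent ends a₁ a₂ a₃) * (Q₀ * B₁ - Q₁ * B₀) =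
        Do (Function.update p e 0) ends o a₁ a₂ a₃ * Q₀ * Q₁ -
          2 * prob (Function.update p e 1) (avoidAll ends a₂ {a₁} ∩ connEvent ends a₂ o) *
            prob (Function.update p e 0) (PDEvent ends a₁ a₂ a₃) * Q₀ -
          DEF (Function.update p e 0) ends o a₁ a₂ a₃ * Q₁ := by
      rw [hB₁', ← hB₀', ← hγD]; ring
    have : 0 ≤ prob (Function.update p e 0) (PDEvent ends a₁ a₂ a₃) * (Q₀ * B₁ - Q₁ * B₀) := by
      rw [key]; exact hdgc
    exact nonneg_of_mul_nonneg_right this hD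
  -- assemble
  rcases eq_or_lt_of_le hQ1nn with hz | hpos
  · -- `Q₁ = 0`: the `p₁`-sums vanish and the cross term is `0`
    have hA₁z : A₁ = 0 := by
      rw [hA₁, sum_Ssig_eq]
      have h1 : prob (Function.update p e 1) (avoidAll ends a₂ {a₁} ∩ connEvent ends a₁ b) = 0 :=
        le_antisymm (le_trans (prob_mono hp₁ Set.inter_subset_left) hz.ge) (prob_nonneg hp₁ _)
      have h2 : prob (Function.update p e 1) (avoidAll ends a₂ {a₁} ∩ connEvent ends a₂ b) = 0 :=
        le_antisymm (le_trans (prob_mono hp₁ Set.inter_subset_left) hz.ge) (prob_nonneg hp₁ _)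
      rw [h1, h2]; ring
    have hB₁z : B₁ = 0 := by
      rw [hB₁, sum_SFg_one p hends o γ, ← hQ₁, ← hz]
      have h2 : prob (Function.update p e 1) (avoidAll ends a₂ {a₁} ∩ connEvent ends a₂ o) = 0 :=
        le_antisymm (le_trans (prob_mono hp₁ Set.inter_subset_left) hz.ge) (prob_nonneg hp₁ _)
      rw [h2]; ring
    have hcross : -((p e * A₁ + (1 - p e) * A₀) * (p e * B₁ + (1 - p e) * B₀) /
        (p e * Q₁ + (1 - p e) * Q₀)) + p e * (A₁ * B₁ / Q₁) + (1 - p e) * (A₀ * B₀ / Q₀) = 0 := by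
      rw [hA₁z, hB₁z, ← hz]
      simp only [mul_zero, zero_add, zero_div, add_zero]
      rw [mul_mul_div_mul]; ring
    linarith [mul_nonneg ht0 h1, mul_nonneg ht1 h₀, hcross]
  · have hQ : 0 < p e * Q₁ + (1 - p e) * Q₀ := by
      rcases eq_or_lt_of_le ht0 with h0 | h0
      · rw [← h0]; simpa using hQ0
      · nlinarith [mul_pos h0 hpos, mul_nonneg ht1 hQ0.le]
    have hcross := cross_identity (p e) A₀ A₁ B₀ B₁ Q₀ Q₁ hQ0.ne' hpos.ne' hQ.ne'
    have hc : 0 ≤ p e * (1 - p e) * ((Q₀ * A₁ - Q₁ * A₀) * (Q₀ * B₁ - Q₁ * B₀)) /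
        ((p e * Q₁ + (1 - p e) * Q₀) * Q₀ * Q₁) :=
      div_nonneg (mul_nonneg (mul_nonneg ht0 ht1) (mul_nonneg hdf hdg))
        (mul_nonneg (mul_nonneg hQ.le hQ0.le) hpos.le)
    linarith [mul_nonneg ht0 h1, mul_nonneg ht1 h₀, hc, hcross]

end Closure

end RootEdge

end CovForm

end Summit.Ventures.PercRepro2
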